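/-
Copyright: the b2b-balaban cell (near-miss cell 7), T⁴-continuum fan-out, NE7b ROUND-2 swarm `t4-ne7b-formalise-*`
(seat leaf-07, gen 2), row S6f «window-drop steps in the zone calculus» of lineage t4-ne7b-p1's claim table
`LEAVES-NE7b.md` — the window-drop port of row S6g′(b) (`HistoryMassPlacementTorus`, leaf-10 g2).
Released under the licence of the surrounding project.
-/
import Summits.QuantumFields.BalabanUV.T4Continuum.Support.HistoryMassPlacementTorus
import Summits.QuantumFields.BalabanUV.T4Continuum.Support.HistoryLevels

/-!
# Mass placement AT LEVELS: the mass-form multiplicity on the torus with window-drop steps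

Summits-side support leaf of the T⁴-continuum cell (rung (B)+1 on a FINITE torus only; NOT infinite volume, NOT the
mass gap, NOT the Clay statement; NOT a proof of the spine estimate NE7b).  Row S6f (window drops) applied to row
S6g′(b) (leaf-10 g2's `HistoryMassPlacement` ∕ `HistoryMassPlacementTorus`, exponent ONE): when the cube lattice of
step `t` is the level-`lv t` blocking (`HistoryLevels.LevelFn K lv`, model scale `levelOf`), the torus TOUCH relation
reads the merger's block at level `lv (st e)` and the free root's cell at scale `lv s`; the blocking fibre at levels is
free (`LevelFn.sub_le`), so the touch count keeps the landed shape `(2ρ+1)^d·(L^d)^{st e+1−s}` and BOTH torus theorems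
of `HistoryMassPlacementTorus` hold verbatim at levels — no deflator is needed on the (b) side (the missing
contraction at a plateau step lives in row S6g′(a)'s cardinality law, which feeds `hzm` and is displayed here exactly
as there).  [folklore] finite counting; nothing is quoted from print, nothing printed is asserted, no `[cite:]` tag,
no `Prop` fact minted (`touchD` is a relation with parameters).

WHAT.  §1 **`touchD n L K lv r t a y s := touchT n L K r (lv t) a y (lv s)`**, `NTD`, `card_touchD_le`, **`NTD_le`**
(`≤ (2r+1)^d·(L^d)^{t+1−s}` for a level function).  §2 **`card_admMSet_root_le_torusD`** and
**`card_admMSet_root_le_torusD_crowd`** = leaf-10 g2's `card_admMSet_root_le_torus` ∕ `_crowd` with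
`touchT n L K (ρ e) (st e)` replaced by `touchD n L K lv (ρ e) (st e)`; conclusions VERBATIM.  §3 sanity.

HONEST DEPENDENCY (cell): continuum YM on T⁴ ⇐ BetaPertH ∧ nine spine estimates (0/9 proved); BetaPertH ⇐ (D1) ∧ (D4)
∧ CAP+tail; G-an2-4 gates asym, D1 and NE2/3/4.  This file changes none of it.  NE7b NOT proved.
-/

open Finset
open Literature.MathematicalPhysics.QuantumFieldTheory.Balaban1983to89
open T4PersistenceDictionary T4PartnerMultiplicity
open Summit.QuantumFields.BalabanUV.T4Continuum.PlacementSkeleton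
open Summit.QuantumFields.BalabanUV.T4Continuum.ZoneSkeleton
open Summit.QuantumFields.BalabanUV.T4Continuum.ZoneTorus
open Summit.QuantumFields.BalabanUV.T4Continuum.HistoryZones

namespace Summit.QuantumFields.BalabanUV.T4Continuum.HistoryMassPlacement

noncomputable section

variable {d : ℕ}

/-! ## §1 Touch at levels and its count -/

/-- **TOUCH AT LEVELS**: `touchT` with the merger's block read at level `lv t` and the free root's cell at scale
`lv s`. [folklore] -/
def touchD (n L K : ℕ) (lv : ℕ → ℕ) (r t : ℕ) (a : Fin d → ℕ) (y : TCell d (n * L ^ K)) (s : ℕ) : Prop :=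
  touchT n L K r (lv t) a y (lv s)

/-- THE TOUCH COUNT AT LEVELS [folklore] -/
def NTD (d L : ℕ) (lv : ℕ → ℕ) (r t s : ℕ) : ℕ := NTT d L r (lv t) (lv s)

section Count

open scoped Classical

/-- **THE ONE-BLOCK TOUCH COUNT AT LEVELS** (= `card_touchT_le` at levels `lv t`, `lv s`). [folklore] -/
theorem card_touchD_le (n : ℕ) {L : ℕ} (hL : 1 ≤ L) (K : ℕ) (lv : ℕ → ℕ) (r t : ℕ) (a : Fin d → ℕ) (s : ℕ) :
    ((univ : Finset (TCell d (n * L ^ K))).filter fun y => touchD n L K lv r t a y s).card ≤ NTD d L lv r t s :=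
  card_touchT_le n hL K r (lv t) a (lv s)

end Count

/-- **THE FIBRE SHAPE AT LEVELS**: for a level function, `NTD d L lv r t s ≤ (2r+1)^d·(L^d)^{t+1−s}` — the landed shape
(`NTT_le`), since `lv t − lv s ≤ t − s` (`LevelFn.sub_le`). [folklore] -/
theorem NTD_le {K : ℕ} {lv : ℕ → ℕ} (h : LevelFn K lv) {L : ℕ} (hL : 1 ≤ L) (d r t s : ℕ) :
    (NTD d L lv r t s : ℝ) ≤ ((2 : ℝ) * r + 1) ^ d * ((L : ℝ) ^ d) ^ (t + 1 - s) := by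
  unfold NTD NTT
  push_cast
  rw [mul_pow, pow_right_comm]
  have hL1 : (1 : ℝ) ≤ (L : ℝ) ^ d := one_le_pow₀ (by exact_mod_cast hL)
  exact mul_le_mul_of_nonneg_left (pow_le_pow_right₀ hL1 (by have := h.sub_le s t; omega)) (by positivity)

/-! ## §2 The mass-form multiplicity on the torus AT LEVELS -/

section Torus

variable {ε : Type*} [DecidableEq ε] [Fintype ε]

open scoped Classical

/-- **THE MASS-FORM MULTIPLICITY ON THE FINITE TORUS, AT LEVELS** (`card_admMSet_root_le_torus` with the touch
relation `touchD n L K lv (ρ e) (st e)` of a level function `lv`): conclusion VERBATIM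
`#admMSet G root c c₀′ ≤ (L^d)^{partnerAges st G}·mergeProd f G`. [folklore] -/
theorem card_admMSet_root_le_torusD (W : ε → ℕ) (n : ℕ) {L : ℕ} (hL : 1 ≤ L) (K : ℕ) {lv : ℕ → ℕ}
    (hlv : LevelFn K lv) (zoneP : ε → Gen ε → (ε → TCell d (n * L ^ K)) → Finset (Fin d → ℕ))
    (hloc : ∀ (e : ε) (Z : Gen ε) (P P' : ε → TCell d (n * L ^ K)), (∀ b ∈ births Z, P b = P' b) →
      zoneP e Z P = zoneP e Z P')
    (ρ st : ε → ℕ) (zmass : ε → Gen ε → ℕ)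
    (hcard : ∀ (e : ε) (Z : Gen ε) (P : ε → TCell d (n * L ^ K)),
      AdmM zoneP (fun e => touchD n L K lv (ρ e) (st e)) Z P → (zoneP e Z P).card ≤ zmass e Z)
    (f : Gen ε → ε → ℝ) (hf : ∀ X Y e, 0 ≤ f (Gen.merge X Y e) e)
    (hzm : ∀ (X Y : Gen ε) (e : ε), (Gen.merge X Y e).WF W →
      (zmass e X : ℝ) * ((2 : ℝ) * ρ e + 1) ^ d ≤ f (Gen.merge X Y e) e ∧
        (zmass e Y : ℝ) * ((2 : ℝ) * ρ e + 1) ^ d ≤ f (Gen.merge X Y e) e)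
    {G : Gen ε} (hW : G.WF W) (c c₀' : TCell d (n * L ^ K)) :
    ((admMSet zoneP (fun e => touchD n L K lv (ρ e) (st e)) G G.root c c₀').card : ℝ) ≤
      ((L : ℝ) ^ d) ^ partnerAges st G * mergeProd f G :=
  card_admMSet_root_le W zoneP hloc (fun e => touchD n L K lv (ρ e) (st e)) zmass
    (fun e s => NTD d L lv (ρ e) (st e) s) hcard (fun e a s => card_touchD_le n hL K lv (ρ e) (st e) a s) st
    (by positivity) (fun e => ((2 : ℝ) * ρ e + 1) ^ d) (fun e s => NTD_le hlv hL d (ρ e) (st e) s) f hf hzm hW c c₀'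

/-- **THE CROWD FORM ON THE TORUS AT LEVELS, EXPONENT ONE** (`card_admMSet_root_le_torus_crowd` with `touchD`):
`#admMSet G root c c₀′ ≤ (L^d)^{partnerAges st G}·((2ρ+1)^d·Cz)^{mergeCount G}·mergeProd q_Z G`. [folklore] -/
theorem card_admMSet_root_le_torusD_crowd (W : ε → ℕ) (n : ℕ) {L : ℕ} (hL : 1 ≤ L) (K : ℕ) {lv : ℕ → ℕ}
    (hlv : LevelFn K lv) (zoneP : ε → Gen ε → (ε → TCell d (n * L ^ K)) → Finset (Fin d → ℕ))
    (hloc : ∀ (e : ε) (Z : Gen ε) (P P' : ε → TCell d (n * L ^ K)), (∀ b ∈ births Z, P b = P' b) →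
      zoneP e Z P = zoneP e Z P')
    (ρ : ℕ) (st : ε → ℕ) (zmass : ε → Gen ε → ℕ)
    (hcard : ∀ (e : ε) (Z : Gen ε) (P : ε → TCell d (n * L ^ K)),
      AdmM zoneP (fun e => touchD n L K lv ρ (st e)) Z P → (zoneP e Z P).card ≤ zmass e Z)
    {Cz σ : ℝ} (hCz : 0 ≤ Cz) (hσ : 0 ≤ σ) (wt : ε → ℝ) (hwt : ∀ w, 0 ≤ wt w)
    (hzm : ∀ (X Y : Gen ε) (e : ε), (Gen.merge X Y e).WF W →
      (zmass e X : ℝ) ≤ Cz * qZ wt σ st (Gen.merge X Y e) (st e) ∧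
        (zmass e Y : ℝ) ≤ Cz * qZ wt σ st (Gen.merge X Y e) (st e))
    {G : Gen ε} (hW : G.WF W) (c c₀' : TCell d (n * L ^ K)) :
    ((admMSet zoneP (fun e => touchD n L K lv ρ (st e)) G G.root c c₀').card : ℝ) ≤
      ((L : ℝ) ^ d) ^ partnerAges st G *
        ((((2 : ℝ) * ρ + 1) ^ d * Cz) ^ mergeCount G * mergeProd (fun Z e => qZ wt σ st Z (st e)) G) :=
  card_admMSet_root_le_crowd W zoneP hloc (fun e => touchD n L K lv ρ (st e)) zmass
    (fun e s => NTD d L lv ρ (st e) s) hcard (fun e a s => card_touchD_le n hL K lv ρ (st e) a s) st (by positivity)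
    (by positivity) hCz hσ (fun e s => NTD_le hlv hL d ρ (st e) s) wt hwt hzm hW c c₀'

end Torus

/-! ## §3 Sanity (decided arithmetic) -/

namespace SanityD

/-- with a plateau between steps `5` and `6` (`lv 5 = lv 6 = 6`) a merger at step `6` attaching a root born at step
`5` pays NO blocking fibre: `NTD = (2r+1)^d` — while the drop-free model would pay `L^d` [folklore] -/
example (L r : ℕ) : NTD 4 L (fun t => if t ≤ 5 then t + 1 else t) r 6 5 = (2 * r + 1) ^ 4 ∧
    NTT 4 L r 6 5 = ((2 * r + 1) * L) ^ 4 := by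
  simp [NTD, NTT]

end SanityD

end

end Summit.QuantumFields.BalabanUV.T4Continuum.HistoryMassPlacement
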